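import Mathlib

/-!
# Stub `stub_holeFree` — Part 1: lattice chains and one-dimensional grid stars

Part 1 of stub `stub_holeFree` (HOLEFREE) of line `rainbow-monomials-in-excursion-kernels`
(skeleton v2) of crux `CardyBoundaryCoulombGas.BoundaryDefectGaussianR`
(stmt-CriticalPhenomena-14132). Pure combinatorics / order lemmas, no topology of the domain yet,
and no definitions (everything is stated with explicit set-builder terms):

* chains of unit lattice steps inside a vertex predicate `P` on `ℤ²`,
  `Relation.ReflTransGen (fun b c ↦ P b ∧ P c ∧ (b₁ - c₁)² + (b₂ - c₂)² = 1)`: symmetry,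
  monotonicity, rows, columns and the **box lemma** `hf_chain_box` (if every lattice point of the
  bounding box of `u, w` satisfies `P` then `u, w` are joined: walk along the row of `u`, then the
  column of `w`); its mesh-position instance is the registered sub-goal `s8_latticeBox`;
* for a finite set `X ⊆ ℝ` of grid values and a centre `ξ`: the closed star
  `{x | ∀ a ∈ X, ¬ (x < a < ξ) ∧ ¬ (ξ < a < x)}` (no grid value strictly between `x` and `ξ`; the
  union of the closed grid intervals containing `ξ`) and the open star
  `{x | ∀ a ∈ X, a ≠ ξ → ¬ (x ≤ a ≤ ξ) ∧ ¬ (ξ ≤ a ≤ x)}`; both are order connected and shrink under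
  small perturbation of the centre, the open star is open and contains an integer multiple of `δ`
  once `δ` is below the gap of `X`, and a point of a closed star can be pushed slightly to one
  side inside it.

All [folklore].
-/

noncomputable section

open Set Metric

namespace Summit.CriticalPhenomena.CardyFormulaZ2.Cruxes.BoundaryDefectGaussianR.RainbowMonomialsInExcursionKernels

/-! ### Lattice chains -/

/-- Real part of the mesh position `v₁ δ + v₂ δ i`. [folklore] -/
theorem hf_mpos_re (δ : ℝ) (v : ℤ × ℤ) :
    ((v.1 : ℂ) * (δ : ℂ) + (v.2 : ℂ) * (δ : ℂ) * Complex.I).re = v.1 * δ := by simp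

/-- Imaginary part of the mesh position `v₁ δ + v₂ δ i`. [folklore] -/
theorem hf_mpos_im (δ : ℝ) (v : ℤ × ℤ) :
    ((v.1 : ℂ) * (δ : ℂ) + (v.2 : ℂ) * (δ : ℂ) * Complex.I).im = v.2 * δ := by simp

/-- The reflexive-transitive closure of a symmetric relation is symmetric. [folklore] -/
theorem hf_rtg_symm {α : Type*} {r : α → α → Prop} (h : ∀ a b, r a b → r b a) {a b : α}
    (hab : Relation.ReflTransGen r a b) : Relation.ReflTransGen r b a := by
  induction hab with
  | refl => exact Relation.ReflTransGen.refl
  | tail _ hbc ih => exact Relation.ReflTransGen.head (h _ _ hbc) ih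

/-- Lattice chains inside a vertex predicate are reversible. [folklore] -/
theorem hf_chain_symm {P : ℤ × ℤ → Prop} {u w : ℤ × ℤ}
    (h : Relation.ReflTransGen
      (fun b c : ℤ × ℤ ↦ P b ∧ P c ∧ (b.1 - c.1) ^ 2 + (b.2 - c.2) ^ 2 = 1) u w) :
    Relation.ReflTransGen
      (fun b c : ℤ × ℤ ↦ P b ∧ P c ∧ (b.1 - c.1) ^ 2 + (b.2 - c.2) ^ 2 = 1) w u := by
  refine hf_rtg_symm (fun b c hbc ↦ ⟨hbc.2.1, hbc.1, ?_⟩) h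
  rw [← hbc.2.2]; ring

/-- A lattice chain inside `P` is a chain for any relation containing the unit steps between
points of `P` (used to pass to mesh positions, to the vertex set and to king steps). [folklore] -/
theorem hf_chain_mono {P : ℤ × ℤ → Prop} {r : ℤ × ℤ → ℤ × ℤ → Prop}
    (hr : ∀ b c : ℤ × ℤ, P b → P c → (b.1 - c.1) ^ 2 + (b.2 - c.2) ^ 2 = 1 → r b c) {u w : ℤ × ℤ}
    (h : Relation.ReflTransGen
      (fun b c : ℤ × ℤ ↦ P b ∧ P c ∧ (b.1 - c.1) ^ 2 + (b.2 - c.2) ^ 2 = 1) u w) :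
    Relation.ReflTransGen r u w := by
  induction h with
  | refl => exact Relation.ReflTransGen.refl
  | tail _ hbc ih => exact ih.tail (hr _ _ hbc.1 hbc.2.1 hbc.2.2)

/-- A unit lattice step is a king step. [folklore] -/
theorem hf_king_of_latt {b c : ℤ × ℤ} (h : (b.1 - c.1) ^ 2 + (b.2 - c.2) ^ 2 = 1) :
    max |b.1 - c.1| |b.2 - c.2| ≤ 1 := by
  have h1 : (b.1 - c.1) ^ 2 ≤ 1 := by nlinarith [sq_nonneg (b.2 - c.2)]
  have h2 : (b.2 - c.2) ^ 2 ≤ 1 := by nlinarith [sq_nonneg (b.1 - c.1)]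
  exact max_le ((sq_le_one_iff_abs_le_one _).1 h1) ((sq_le_one_iff_abs_le_one _).1 h2)

/-- One unit step to the right. [folklore] -/
theorem hf_chain_step_right {P : ℤ × ℤ → Prop} {a k : ℤ} (ha : P (a, k)) (hb : P (a + 1, k)) :
    Relation.ReflTransGen
      (fun b c : ℤ × ℤ ↦ P b ∧ P c ∧ (b.1 - c.1) ^ 2 + (b.2 - c.2) ^ 2 = 1) (a, k) (a + 1, k) :=
  Relation.ReflTransGen.single ⟨ha, hb, by norm_num⟩

/-- One unit step upwards. [folklore] -/
theorem hf_chain_step_up {P : ℤ × ℤ → Prop} {a k : ℤ} (ha : P (a, k)) (hb : P (a, k + 1)) :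
    Relation.ReflTransGen
      (fun b c : ℤ × ℤ ↦ P b ∧ P c ∧ (b.1 - c.1) ^ 2 + (b.2 - c.2) ^ 2 = 1) (a, k) (a, k + 1) :=
  Relation.ReflTransGen.single ⟨ha, hb, by norm_num⟩

/-- A row of lattice points of `P`, traversed to the right, is a chain. [folklore] -/
theorem hf_chain_run_right {P : ℤ × ℤ → Prop} (a k : ℤ) {b : ℤ} (hab : a ≤ b)
    (h : ∀ j : ℤ, a ≤ j → j ≤ b → P (j, k)) :
    Relation.ReflTransGen
      (fun b c : ℤ × ℤ ↦ P b ∧ P c ∧ (b.1 - c.1) ^ 2 + (b.2 - c.2) ^ 2 = 1) (a, k) (b, k) := by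
  induction b, hab using Int.leInduction with
  | base => exact Relation.ReflTransGen.refl
  | succ b hab ih =>
    exact (ih fun j hj hjb ↦ h j hj (by omega)).trans
      (hf_chain_step_right (h b hab (by omega)) (h (b + 1) (by omega) le_rfl))

/-- A column of lattice points of `P`, traversed upwards, is a chain. [folklore] -/
theorem hf_chain_run_up {P : ℤ × ℤ → Prop} (a k : ℤ) {l : ℤ} (hkl : k ≤ l)
    (h : ∀ j : ℤ, k ≤ j → j ≤ l → P (a, j)) :
    Relation.ReflTransGen
      (fun b c : ℤ × ℤ ↦ P b ∧ P c ∧ (b.1 - c.1) ^ 2 + (b.2 - c.2) ^ 2 = 1) (a, k) (a, l) := by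
  induction l, hkl using Int.leInduction with
  | base => exact Relation.ReflTransGen.refl
  | succ l hkl ih =>
    exact (ih fun j hj hjl ↦ h j hj (by omega)).trans
      (hf_chain_step_up (h l hkl (by omega)) (h (l + 1) (by omega) le_rfl))

/-- A row of lattice points of `P` is a chain (either direction). [folklore] -/
theorem hf_chain_row {P : ℤ × ℤ → Prop} (a b k : ℤ)
    (h : ∀ j : ℤ, min a b ≤ j → j ≤ max a b → P (j, k)) :
    Relation.ReflTransGen
      (fun b c : ℤ × ℤ ↦ P b ∧ P c ∧ (b.1 - c.1) ^ 2 + (b.2 - c.2) ^ 2 = 1) (a, k) (b, k) := by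
  rcases le_total a b with hab | hba
  · exact hf_chain_run_right a k hab fun j hj hjb ↦ h j (by omega) (by omega)
  · exact hf_chain_symm (hf_chain_run_right b k hba fun j hj hjb ↦ h j (by omega) (by omega))

/-- A column of lattice points of `P` is a chain (either direction). [folklore] -/
theorem hf_chain_col {P : ℤ × ℤ → Prop} (a k l : ℤ)
    (h : ∀ j : ℤ, min k l ≤ j → j ≤ max k l → P (a, j)) :
    Relation.ReflTransGen
      (fun b c : ℤ × ℤ ↦ P b ∧ P c ∧ (b.1 - c.1) ^ 2 + (b.2 - c.2) ^ 2 = 1) (a, k) (a, l) := by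
  rcases le_total k l with hkl | hlk
  · exact hf_chain_run_up a k hkl fun j hj hjl ↦ h j (by omega) (by omega)
  · exact hf_chain_symm (hf_chain_run_up a l hlk fun j hj hjl ↦ h j (by omega) (by omega))

/-- **Box lemma.** If every lattice point of the bounding box of `u, w` satisfies `P`, then `u`
and `w` are joined by a lattice chain inside `P` (walk along the row of `u` to the column of `w`,
then along that column). [folklore] -/
theorem hf_chain_box {P : ℤ × ℤ → Prop} (u w : ℤ × ℤ)
    (h : ∀ m : ℤ × ℤ, min u.1 w.1 ≤ m.1 → m.1 ≤ max u.1 w.1 → min u.2 w.2 ≤ m.2 →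
      m.2 ≤ max u.2 w.2 → P m) :
    Relation.ReflTransGen
      (fun b c : ℤ × ℤ ↦ P b ∧ P c ∧ (b.1 - c.1) ^ 2 + (b.2 - c.2) ^ 2 = 1) u w := by
  obtain ⟨a, k⟩ := u
  obtain ⟨b, l⟩ := w
  dsimp only at h
  exact (hf_chain_row a b k fun j hj hjb ↦ h (j, k) hj hjb (by omega) (by omega)).trans
    (hf_chain_col b k l fun j hj hjl ↦ h (b, j) (by omega) (by omega) hj hjl)

/-- **Registered sub-goal `s8_latticeBox` (HOLEFREE, lattice part).** If every lattice point of
the bounding box of `u, w ∈ ℤ²` has mesh position in `S`, then `u` and `w` are joined by a chain of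
unit lattice steps through lattice points with mesh positions in `S`. [folklore] -/
theorem s8_latticeBox :
    ∀ (S : Set ℂ) (δ : ℝ) (u w : ℤ × ℤ), (∀ m : ℤ × ℤ, min u.1 w.1 ≤ m.1 → m.1 ≤ max u.1 w.1 →
    min u.2 w.2 ≤ m.2 → m.2 ≤ max u.2 w.2 → ((m.1 : ℂ) * (δ : ℂ) + (m.2 : ℂ) * (δ : ℂ) * Complex.I)
    ∈ S) → Relation.ReflTransGen (fun b c : ℤ × ℤ ↦ ((b.1 : ℂ) * (δ : ℂ) + (b.2 : ℂ) * (δ : ℂ) *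
    Complex.I) ∈ S ∧ ((c.1 : ℂ) * (δ : ℂ) + (c.2 : ℂ) * (δ : ℂ) * Complex.I) ∈ S ∧
    (b.1 - c.1) ^ 2 + (b.2 - c.2) ^ 2 = 1) u w :=
  fun S δ u w h ↦ hf_chain_box
    (P := fun m : ℤ × ℤ ↦ ((m.1 : ℂ) * (δ : ℂ) + (m.2 : ℂ) * (δ : ℂ) * Complex.I) ∈ S) u w h

/-- A lattice coordinate between two lattice coordinates stays between them after scaling by
`δ ≥ 0`. [folklore] -/
theorem hf_mul_mem_uIcc {a b m : ℤ} {δ : ℝ} (hδ : 0 ≤ δ) (h₁ : min a b ≤ m) (h₂ : m ≤ max a b) :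
    (m : ℝ) * δ ∈ Set.uIcc ((a : ℝ) * δ) ((b : ℝ) * δ) := by
  rcases le_total a b with hab | hba
  · have h₁' : (a : ℝ) ≤ m := by exact_mod_cast (by omega : a ≤ m)
    have h₂' : (m : ℝ) ≤ b := by exact_mod_cast (by omega : m ≤ b)
    rw [Set.uIcc_of_le (mul_le_mul_of_nonneg_right (by exact_mod_cast hab) hδ)]
    exact ⟨mul_le_mul_of_nonneg_right h₁' hδ, mul_le_mul_of_nonneg_right h₂' hδ⟩
  · have h₁' : (b : ℝ) ≤ m := by exact_mod_cast (by omega : b ≤ m)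
    have h₂' : (m : ℝ) ≤ a := by exact_mod_cast (by omega : m ≤ a)
    rw [Set.uIcc_of_ge (mul_le_mul_of_nonneg_right (by exact_mod_cast hba) hδ)]
    exact ⟨mul_le_mul_of_nonneg_right h₁' hδ, mul_le_mul_of_nonneg_right h₂' hδ⟩

/-! ### One-dimensional grid stars -/

/-- A point lies in its own closed star. [folklore] -/
theorem hf_star_self (X : Finset ℝ) (ξ : ℝ) :
    ξ ∈ {x : ℝ | ∀ a ∈ X, ¬ (x < a ∧ a < ξ) ∧ ¬ (ξ < a ∧ a < x)} :=
  fun _ _ ↦ ⟨fun h ↦ lt_irrefl _ (h.1.trans h.2), fun h ↦ lt_irrefl _ (h.1.trans h.2)⟩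

/-- A point lies in its own open star. [folklore] -/
theorem hf_ostar_self (X : Finset ℝ) (ξ : ℝ) :
    ξ ∈ {x : ℝ | ∀ a ∈ X, a ≠ ξ → ¬ (x ≤ a ∧ a ≤ ξ) ∧ ¬ (ξ ≤ a ∧ a ≤ x)} :=
  fun _ _ ha ↦ ⟨fun h ↦ ha (le_antisymm h.2 h.1), fun h ↦ ha (le_antisymm h.2 h.1)⟩

/-- The closed star relation is symmetric. [folklore] -/
theorem hf_star_comm {X : Finset ℝ} {ξ ζ : ℝ} :
    ζ ∈ {x : ℝ | ∀ a ∈ X, ¬ (x < a ∧ a < ξ) ∧ ¬ (ξ < a ∧ a < x)} ↔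
      ξ ∈ {x : ℝ | ∀ a ∈ X, ¬ (x < a ∧ a < ζ) ∧ ¬ (ζ < a ∧ a < x)} :=
  forall₂_congr fun _ _ ↦ and_comm

/-- The open star lies in the closed star. [folklore] -/
theorem hf_ostar_subset_star (X : Finset ℝ) (ξ : ℝ) :
    {x : ℝ | ∀ a ∈ X, a ≠ ξ → ¬ (x ≤ a ∧ a ≤ ξ) ∧ ¬ (ξ ≤ a ∧ a ≤ x)} ⊆
      {x : ℝ | ∀ a ∈ X, ¬ (x < a ∧ a < ξ) ∧ ¬ (ξ < a ∧ a < x)} :=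
  fun _ hx a ha ↦ ⟨fun h ↦ (hx a ha h.2.ne).1 ⟨h.1.le, h.2.le⟩,
    fun h ↦ (hx a ha h.1.ne').2 ⟨h.1.le, h.2.le⟩⟩

/-- Closed stars are order connected (intervals). [folklore] -/
theorem hf_star_ordConnected (X : Finset ℝ) (ξ : ℝ) :
    Set.OrdConnected {x : ℝ | ∀ a ∈ X, ¬ (x < a ∧ a < ξ) ∧ ¬ (ξ < a ∧ a < x)} :=
  ⟨fun _ hx _ hy _ hm a ha ↦ ⟨fun h ↦ (hx a ha).1 ⟨hm.1.trans_lt h.1, h.2⟩,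
    fun h ↦ (hy a ha).2 ⟨h.1, h.2.trans_le hm.2⟩⟩⟩

/-- Open stars are order connected (intervals). [folklore] -/
theorem hf_ostar_ordConnected (X : Finset ℝ) (ξ : ℝ) :
    Set.OrdConnected {x : ℝ | ∀ a ∈ X, a ≠ ξ → ¬ (x ≤ a ∧ a ≤ ξ) ∧ ¬ (ξ ≤ a ∧ a ≤ x)} :=
  ⟨fun _ hx _ hy _ hm a ha hne ↦ ⟨fun h ↦ (hx a ha hne).1 ⟨hm.1.trans h.1, h.2⟩,
    fun h ↦ (hy a ha hne).2 ⟨h.1, h.2.trans hm.2⟩⟩⟩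

/-- No grid value lies strictly between `ξ` and a point of its closed star. [folklore] -/
theorem hf_not_mem_Ioo_of_star {X : Finset ℝ} {ξ x a : ℝ}
    (hx : x ∈ {x : ℝ | ∀ a ∈ X, ¬ (x < a ∧ a < ξ) ∧ ¬ (ξ < a ∧ a < x)}) (ha : a ∈ X) :
    a ∉ Set.Ioo (min ξ x) (max ξ x) := by
  intro h
  rcases le_total ξ x with hle | hle
  · rw [min_eq_left hle, max_eq_right hle] at h
    exact (hx a ha).2 ⟨h.1, h.2⟩
  · rw [min_eq_right hle, max_eq_left hle] at h
    exact (hx a ha).1 ⟨h.1, h.2⟩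

/-- A finite set of reals keeps a positive distance from any point (other than itself).
[folklore] -/
theorem hf_exists_radius (T : Finset ℝ) (x : ℝ) : ∃ r > 0, ∀ a ∈ T, a ≠ x → r ≤ |a - x| := by
  classical
  induction T using Finset.induction_on with
  | empty => exact ⟨1, one_pos, by simp⟩
  | insert b T hb ih =>
    obtain ⟨r, hr, hT⟩ := ih
    by_cases hbx : b = x
    · refine ⟨r, hr, fun a ha hax ↦ ?_⟩
      rcases Finset.mem_insert.1 ha with hab | ha
      · exact absurd (hab.trans hbx) hax
      · exact hT a ha hax
    · refine ⟨min r |b - x|, lt_min hr (abs_pos.2 (sub_ne_zero.2 hbx)), fun a ha hax ↦ ?_⟩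
      rcases Finset.mem_insert.1 ha with hab | ha
      · rw [hab]; exact min_le_right _ _
      · exact (min_le_left _ _).trans (hT a ha hax)

/-- A finite set of reals has a positive gap: distinct elements are at least `ρ > 0` apart.
[folklore] -/
theorem hf_exists_gap (T : Finset ℝ) : ∃ ρ > 0, ∀ a ∈ T, ∀ a' ∈ T, a ≠ a' → ρ ≤ |a - a'| := by
  classical
  induction T using Finset.induction_on with
  | empty => exact ⟨1, one_pos, by simp⟩
  | insert b T hb ih =>
    obtain ⟨ρ, hρ, hT⟩ := ih
    obtain ⟨r, hr, hrT⟩ := hf_exists_radius T b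
    refine ⟨min ρ r, lt_min hρ hr, fun a ha a' ha' haa' ↦ ?_⟩
    rcases Finset.mem_insert.1 ha with hab | haT <;>
      rcases Finset.mem_insert.1 ha' with hab' | ha'T
    · exact absurd (hab.trans hab'.symm) haa'
    · rw [hab, abs_sub_comm]
      exact (min_le_right _ _).trans (hrT a' ha'T fun h ↦ haa' (hab.trans h.symm))
    · rw [hab']
      exact (min_le_right _ _).trans (hrT a haT fun h ↦ haa' (h.trans hab'.symm))
    · exact (min_le_left _ _).trans (hT a haT a' ha'T haa')

/-- **Closed stars shrink under small perturbation of the centre**: if `η` is closer to `ξ` than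
every grid value `≠ ξ`, then the closed star of `η` lies in that of `ξ`. [folklore] -/
theorem hf_star_subset_of_near {X : Finset ℝ} {ξ r : ℝ} (hr : ∀ a ∈ X, a ≠ ξ → r ≤ |a - ξ|)
    {η : ℝ} (hη : |η - ξ| < r) :
    {x : ℝ | ∀ a ∈ X, ¬ (x < a ∧ a < η) ∧ ¬ (η < a ∧ a < x)} ⊆
      {x : ℝ | ∀ a ∈ X, ¬ (x < a ∧ a < ξ) ∧ ¬ (ξ < a ∧ a < x)} := by
  intro x hx a ha
  have key : |a - ξ| < r → a = ξ := fun h ↦ by_contra fun hne ↦ (hr a ha hne).not_gt h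
  rw [abs_sub_lt_iff] at hη
  constructor
  · rintro ⟨hxa, haξ⟩
    have haη : η ≤ a := not_lt.1 fun h ↦ (hx a ha).1 ⟨hxa, h⟩
    have : a = ξ := key (by rw [abs_sub_lt_iff]; constructor <;> linarith)
    exact absurd this haξ.ne
  · rintro ⟨hξa, hax⟩
    have haη : a ≤ η := not_lt.1 fun h ↦ (hx a ha).2 ⟨h, hax⟩
    have : a = ξ := key (by rw [abs_sub_lt_iff]; constructor <;> linarith)
    exact absurd this hξa.ne'

/-- **Open stars shrink under small perturbation of the centre.** [folklore] -/
theorem hf_ostar_subset_of_near {X : Finset ℝ} {ξ r : ℝ} (hr : ∀ a ∈ X, a ≠ ξ → r ≤ |a - ξ|)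
    {η : ℝ} (hη : |η - ξ| < r) :
    {x : ℝ | ∀ a ∈ X, a ≠ η → ¬ (x ≤ a ∧ a ≤ η) ∧ ¬ (η ≤ a ∧ a ≤ x)} ⊆
      {x : ℝ | ∀ a ∈ X, a ≠ ξ → ¬ (x ≤ a ∧ a ≤ ξ) ∧ ¬ (ξ ≤ a ∧ a ≤ x)} := by
  intro x hx a ha haξ
  have hclose : ¬ (|a - ξ| < r) := not_lt.2 (hr a ha haξ)
  rw [abs_sub_lt_iff] at hη hclose
  constructor
  · rintro ⟨hxa, haξ'⟩
    have haη : η < a := by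
      by_contra hle
      push Not at hle
      rcases eq_or_ne a η with hea | hne
      · exact hclose ⟨by linarith, by linarith⟩
      · exact (hx a ha hne).1 ⟨hxa, hle⟩
    exact hclose ⟨by linarith, by linarith⟩
  · rintro ⟨hξa, hax⟩
    have haη : a < η := by
      by_contra hle
      push Not at hle
      rcases eq_or_ne a η with hea | hne
      · exact hclose ⟨by linarith, by linarith⟩
      · exact (hx a ha hne).2 ⟨hle, hax⟩
    exact hclose ⟨by linarith, by linarith⟩

/-- **Open stars are open.** [folklore] -/
theorem hf_ostar_isOpen (X : Finset ℝ) (ξ : ℝ) :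
    IsOpen {x : ℝ | ∀ a ∈ X, a ≠ ξ → ¬ (x ≤ a ∧ a ≤ ξ) ∧ ¬ (ξ ≤ a ∧ a ≤ x)} := by
  refine Metric.isOpen_iff.2 fun x hx ↦ ?_
  obtain ⟨r, hr, hrx⟩ := hf_exists_radius X x
  refine ⟨r, hr, fun y hy a ha haξ ↦ ?_⟩
  rw [Metric.mem_ball, Real.dist_eq, abs_sub_lt_iff] at hy
  have hax : a ≠ x := by
    rintro rfl
    rcases le_total a ξ with h | h
    · exact (hx a ha haξ).1 ⟨le_rfl, h⟩
    · exact (hx a ha haξ).2 ⟨h, le_rfl⟩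
  have hfar := hrx a ha hax
  constructor
  · rintro ⟨hya, haξ'⟩
    have hxa : a < x := not_le.1 fun h ↦ (hx a ha haξ).1 ⟨h, haξ'⟩
    rw [abs_of_neg (sub_neg.2 hxa)] at hfar
    linarith
  · rintro ⟨hξa, hay⟩
    have hxa : x < a := not_le.1 fun h ↦ (hx a ha haξ).2 ⟨hξa, h⟩
    rw [abs_of_pos (sub_pos.2 hxa)] at hfar
    linarith

/-- A real outside an open star is blocked by a grid value other than the centre. [folklore] -/
theorem hf_not_mem_ostar {X : Finset ℝ} {ξ x : ℝ}
    (h : x ∉ {x : ℝ | ∀ a ∈ X, a ≠ ξ → ¬ (x ≤ a ∧ a ≤ ξ) ∧ ¬ (ξ ≤ a ∧ a ≤ x)}) :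
    ∃ a ∈ X, a ≠ ξ ∧ ((x ≤ a ∧ a ≤ ξ) ∨ (ξ ≤ a ∧ a ≤ x)) := by
  by_contra hh
  exact h fun a ha haξ ↦
    ⟨fun hP ↦ hh ⟨a, ha, haξ, Or.inl hP⟩, fun hQ ↦ hh ⟨a, ha, haξ, Or.inr hQ⟩⟩

/-- **Open stars contain lattice values at fine mesh.** If distinct grid values are `≥ ρ` apart and
`0 < δ < ρ`, every open star contains an integer multiple of `δ` (one of the two multiples of `δ`
around the centre). [folklore] -/
theorem hf_exists_int_mul_mem_ostar {X : Finset ℝ} {ρ : ℝ}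
    (hgap : ∀ a ∈ X, ∀ a' ∈ X, a ≠ a' → ρ ≤ |a - a'|) {δ : ℝ} (hδ : 0 < δ) (hδρ : δ < ρ)
    (ξ : ℝ) :
    ∃ j : ℤ, (j : ℝ) * δ ∈ {x : ℝ | ∀ a ∈ X, a ≠ ξ → ¬ (x ≤ a ∧ a ≤ ξ) ∧ ¬ (ξ ≤ a ∧ a ≤ x)} := by
  set j : ℤ := ⌊ξ / δ⌋ with hj
  have hj₁ : (j : ℝ) * δ ≤ ξ := by have := Int.floor_le (ξ / δ); rwa [le_div_iff₀ hδ] at this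
  have hj₂ : ξ < ((j : ℝ) + 1) * δ := by
    have := Int.lt_floor_add_one (ξ / δ); rwa [div_lt_iff₀ hδ] at this
  by_cases h₁ : (j : ℝ) * δ ∈ {x : ℝ | ∀ a ∈ X, a ≠ ξ → ¬ (x ≤ a ∧ a ≤ ξ) ∧ ¬ (ξ ≤ a ∧ a ≤ x)}
  · exact ⟨j, h₁⟩
  by_cases h₂ : ((j + 1 : ℤ) : ℝ) * δ ∈
      {x : ℝ | ∀ a ∈ X, a ≠ ξ → ¬ (x ≤ a ∧ a ≤ ξ) ∧ ¬ (ξ ≤ a ∧ a ≤ x)}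
  · exact ⟨j + 1, h₂⟩
  exfalso
  obtain ⟨a, ha, haξ, hor⟩ := hf_not_mem_ostar h₁
  obtain ⟨a', ha', ha'ξ, hor'⟩ := hf_not_mem_ostar h₂
  push_cast at hor'
  have ha₁ : (j : ℝ) * δ ≤ a ∧ a < ξ := by
    rcases hor with h | h
    · exact ⟨h.1, lt_of_le_of_ne h.2 haξ⟩
    · exact absurd (le_antisymm (h.2.trans hj₁) h.1) haξ
  have ha₂ : ξ < a' ∧ a' ≤ ((j : ℝ) + 1) * δ := by
    rcases hor' with h | h
    · exact absurd (le_antisymm h.2 (hj₂.le.trans h.1)) ha'ξ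
    · exact ⟨lt_of_le_of_ne h.1 (Ne.symm ha'ξ), h.2⟩
  have hne : a ≠ a' := fun h ↦ by rw [h] at ha₁; exact lt_irrefl _ (ha₁.2.trans ha₂.1)
  have hgap' := hgap a ha a' ha' hne
  rw [abs_sub_comm, abs_of_pos (sub_pos.2 (ha₁.2.trans ha₂.1))] at hgap'
  nlinarith [ha₁.1, ha₂.2]

/-- **Pushing a point of a closed star off its position.** A point `x` of the closed star of `ξ`
can be moved a little in one of the two directions while staying in the closed star (towards `ξ`,
or anywhere if `x = ξ`). [folklore] -/
theorem hf_exists_perturb {X : Finset ℝ} {ξ x : ℝ}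
    (hx : x ∈ {x : ℝ | ∀ a ∈ X, ¬ (x < a ∧ a < ξ) ∧ ¬ (ξ < a ∧ a < x)}) :
    ∃ σ : ℝ, (σ = 1 ∨ σ = -1) ∧ ∃ r > 0, ∀ t : ℝ, 0 < t → t < r →
      x + σ * t ∈ {x : ℝ | ∀ a ∈ X, ¬ (x < a ∧ a < ξ) ∧ ¬ (ξ < a ∧ a < x)} := by
  obtain ⟨r, hr, hrx⟩ := hf_exists_radius X x
  have hfar : ∀ a ∈ X, x - r < a → a < x + r → a = x := by
    intro a ha h1 h2
    by_contra hne
    have h3 := hrx a ha hne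
    have h4 : |a - x| < r := abs_sub_lt_iff.2 ⟨by linarith, by linarith⟩
    linarith
  rcases lt_or_ge x ξ with hxξ | hξx
  · refine ⟨1, Or.inl rfl, r, hr, fun t ht htr a ha ↦ ⟨fun h ↦ ?_, fun h ↦ ?_⟩⟩
    · exact (hx a ha).1 ⟨by linarith [h.1], h.2⟩
    · rcases le_or_gt a x with hax | hax
      · linarith [h.1]
      · have := hfar a ha (by linarith) (by linarith [h.2])
        linarith
  · refine ⟨-1, Or.inr rfl, r, hr, fun t ht htr a ha ↦ ⟨fun h ↦ ?_, fun h ↦ ?_⟩⟩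
    · have := hfar a ha (by linarith [h.1]) (by linarith [h.2])
      rw [this] at h
      linarith [h.2]
    · exact (hx a ha).2 ⟨h.1, by linarith [h.2]⟩

end Summit.CriticalPhenomena.CardyFormulaZ2.Cruxes.BoundaryDefectGaussianR.RainbowMonomialsInExcursionKernels

end
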